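import Mathlib.LinearAlgebra.Matrix.Rank
import Mathlib.FieldTheory.RatFunc.AsPolynomial
import Literature.Combinatorics.SimpleGraph.PRankLeRank
import Literature.Computability.AlgebraicComplexity.Forbes15SupportBoundLinear
import HarnessLib

/-!
# The shifted-partials measure does not grow in the limit `ε → 0`
# (Dutta–Dwivedi–Saxena 2021, §6.1, Claim 6.5; Forbes 2015, Prop. 6.5 for approximated sums)

P. Dutta, P. Dwivedi, N. Saxena, *Demystifying the border of depth-3 algebraic circuits*, FOCS 2021
[DuttaDwivediSaxena2022], full version (held `paper:galaxy-pdf-7641649743695546420`) §6.1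
"Efficient hitting set for `\overline{Σ∧ΣΠ^{[δ]}}`", p0045–p0047:

* **Lemma 6.1** (measure upper bound, = [Forbes 2015, Cor. 6.4] read over `𝓡 = F(ε)`): for
  `g ∈ 𝓡[x]` computed by a `Σ∧ΣΠ^{[δ]}` circuit of top fan-in `s`,
  `rk 𝐱^{≤ℓ}∂_{≤m}(g) ≤ s·m·C(n+(δ−1)m+ℓ, (δ−1)m+ℓ)`.
* **Prop. 6.2 / Lemma 6.3** (the trailing monomial lower-bounds the measure; [Forbes 2015,
  Lemma 4.13]): `rk 𝐱^{≤ℓ}∂_{≤m}(𝐱^a) ≥ C(η,m)·C(η−m+ℓ,ℓ)`, `η = |supp 𝐱^a|`.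
* **Claim 6.5** (p0046, L1228–1236): "Define the coefficient matrix `N(ρ(g))` … Note that
  `rk_{F(ε)} N(ρ(g)) ≤ R`. … For any `r > R`, let `𝒩` be an `r × r` sub-matrix of `N(ρ(g))`. The
  rank bound ensures `det 𝒩(ρ(g)) = 0`. This will remain true under the limit `ε = 0`; thus
  `det(𝒩(ρ(f))) = 0`. … we deduce `rk_F N(ρ(f)) ≤ R`."
* **Lemma 6.4** (trailing monomial support): if such a `g = f + ε·Q` approximates `f ∈ F[x]`,
  then `|supp TM(f)| = O(δ log s)` — by comparing the two bounds exactly as in [Forbes 2015,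
  Prop. 6.5 / Lemma A.6].

This file is the MEASURE-THEORETIC core of that argument, written once for an arbitrary
specialisation: a commutative ring `R` (read `F[ε]`), a ring map `φ : R →+* F` into a field (read
`ε ↦ 0`) and an INJECTIVE ring map `ι : R →+* K` into a field (read `F[ε] ⊂ F(ε)`). All theorems,
no named facts (D-0026); no `instance`, no notation. The measure, the stages, the spanning family
`ubFamily` and the lower-bound family `lbFamily` are the tree's (`Forbes15ShiftedPartialsDefs`,
`Forbes15ShiftedPartials`), the rank comparison under `(φ, ι)` is the tree's
`Literature.Combinatorics.SimpleGraph.PRankLeRank.rank_map_le_rank_map` (rank = largest non-vanishing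
minor, exactly the printed proof of Claim 6.5), and the final arithmetic is the tree's
`Forbes15SupportBoundLinear.lt_of_measureIneq_linear` (constant linear in the bottom degree).

* `finrank_span_range_eq_rank` — the finrank of the span of finitely many polynomials is the rank
  of their coefficient matrix (columns = a finite set of monomials containing all supports).
* `finrank_span_range_map_le` — for a finite family `P_x ∈ R[x]`:
  `finrank_F span{φ P_x} ≤ finrank_K span{ι P_x}`.
* `map_shiftDerivList`, `measure_eq_span_range`, `finrank_measure_map_le` — Forbes's operators
  `x^c (x+α)^{1_B} ∂_{x^{1_B}}` commute with `map`, so the measure of `φ P` has finrank at most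
  that of `ι P` (**DDS Claim 6.5**).
* `border_choose_mul_choose_le` — the measure inequality of [Forbes 2015, Prop. 6.5] in the
  APPROXIMATIVE setting: the lower bound is taken for `f = φ P` over `F` (trailing monomial of
  full support), the upper bound for `g = ι P = Σ_{i<s} u_i G_i^{d_i}` over `K` (**DDS Lemma 6.1 +
  (6.1) + Claim 6.5**).
* `border_card_lt_of_isTrailing_linear` — hence `n < 33(t+2)(⌊log₂ s⌋+1)` (**DDS Lemma 6.4**, the
  constant of `Forbes15SupportBoundLinear`).
* `border_card_lt_of_isTrailing_linear_ratFunc` — the instance `R = F[ε]`, `K = F(ε) = RatFunc F`,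
  `φ = constantCoeff`.

Honest framing: technical lemmas about a 2015/2021 published method; nothing here bears on
`VP ≠ VNP`, which is NOT proved. Consumer: `DDS21BorderWedgeHittingProofs.lean`
(`DDS2021_thm_6_6_holds`).

## References
* [DuttaDwivediSaxena2022] §6.1, Lemma 6.1–6.4, Claim 6.5 (full version p0045:L11–p0047:L9,
  printed lines 1195–1243).
* [Forbes2015] M. A. Forbes, *Deterministic divisibility testing via shifted partial derivatives*,
  FOCS 2015, Cor. 6.4, Lemma 4.13, Prop. 6.5, Lemma A.6.
* [BrouwerHaemers2012] §13.3 Prop. 13.3.1 (rank under a ring map ≤ rank over the fraction field —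
  the minors argument; tree file `PRankLeRank.lean`).
-/

open MvPolynomial

namespace Literature.Computability.AlgebraicComplexity.Forbes15

/-! ### Finrank of a span of polynomials = rank of the coefficient matrix -/

section CoeffMatrix

variable {E : Type*} [Field E] {σ : Type*} {κ : Type*} [Fintype κ]

/-- The coefficient functional onto a finite set `T` of monomials, `p ↦ (coeff m p)_{m ∈ T}`.
[cite: DuttaDwivediSaxena2022, §6.1 Claim 6.5 (proof: "the coefficient matrix `N(ρ(g))`")] -/
noncomputable def coeffVecOn (T : Finset (σ →₀ ℕ)) : MvPolynomial σ E →ₗ[E] (T → E) where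
  toFun p m := coeff m.1 p
  map_add' p q := by funext m; simp
  map_smul' c p := by funext m; simp [smul_eq_mul]

/-- Unfolding `coeffVecOn`. [folklore] -/
@[simp] private theorem coeffVecOn_apply (T : Finset (σ →₀ ℕ)) (p : MvPolynomial σ E) (m : T) :
    coeffVecOn (E := E) T p m = coeff m.1 p := rfl

omit [Fintype κ] in
/-- A polynomial in the span of a family supported in `T` is supported in `T`. [folklore] -/
private theorem support_subset_of_mem_span {T : Finset (σ →₀ ℕ)} {w : κ → MvPolynomial σ E}
    (hw : ∀ x, (w x).support ⊆ T) {p : MvPolynomial σ E}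
    (hp : p ∈ Submodule.span E (Set.range w)) : p.support ⊆ T := by
  classical
  induction hp using Submodule.span_induction with
  | mem q hq => obtain ⟨x, rfl⟩ := hq; exact hw x
  | zero => simp
  | add p q _ _ hp hq => exact (support_add).trans (Finset.union_subset hp hq)
  | smul c p _ hp => exact (support_smul).trans hp

/-- `coeffVecOn T` is injective on polynomials supported in `T`. [folklore] -/
private theorem eq_zero_of_coeffVecOn_eq_zero {T : Finset (σ →₀ ℕ)} {p : MvPolynomial σ E}
    (hp : p.support ⊆ T) (h : coeffVecOn (E := E) T p = 0) : p = 0 := by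
  classical
  ext m
  rw [coeff_zero]
  by_cases hm : m ∈ T
  · have := congrFun h ⟨m, hm⟩
    simpa using this
  · exact notMem_support_iff.mp fun h' => hm (hp h')

/-- **Finrank of a span of polynomials = rank of their coefficient matrix** (rows = the family,
columns = a finite set of monomials containing every support).
[cite: DuttaDwivediSaxena2022, §6.1 Claim 6.5 (proof: "linear dependence is preserved")] -/
theorem finrank_span_range_eq_rank (T : Finset (σ →₀ ℕ)) (w : κ → MvPolynomial σ E)
    (hw : ∀ x, (w x).support ⊆ T) :
    Module.finrank E (Submodule.span E (Set.range w)) =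
      (Matrix.of fun (x : κ) (m : T) => coeff m.1 (w x)).rank := by
  classical
  set N := Submodule.span E (Set.range w) with hN
  set Ψ : MvPolynomial σ E →ₗ[E] (T → E) := coeffVecOn T with hΨ
  -- the rows of the coefficient matrix are `Ψ ∘ w`
  have hrows : (Matrix.of fun (x : κ) (m : T) => coeff m.1 (w x)).row = Ψ ∘ w := by
    funext x m
    rfl
  rw [Matrix.rank_eq_finrank_span_row, hrows, Set.range_comp, ← Submodule.map_span]
  -- `Ψ` is injective on `N`
  have hinj : Function.Injective (Ψ.domRestrict N) := by
    intro p q hpq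
    apply Subtype.ext
    have h0 : Ψ (p.1 - q.1) = 0 := by
      rw [map_sub, sub_eq_zero]
      exact hpq
    have hsupp : (p.1 - q.1).support ⊆ T :=
      support_subset_of_mem_span hw (N.sub_mem p.2 q.2)
    exact sub_eq_zero.mp (eq_zero_of_coeffVecOn_eq_zero hsupp h0)
  rw [← LinearMap.finrank_range_of_inj hinj, LinearMap.range_domRestrict]

end CoeffMatrix

/-! ### Semicontinuity of the span-rank under specialisation -/

section Specialisation

variable {R K F : Type*} [CommRing R] [Field K] [Field F] {σ : Type*} {κ : Type*} [Fintype κ]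

/-- **Rank does not grow under specialisation (DDS Claim 6.5, abstract form).** For a finite
family `P_x ∈ R[x]`, a ring map `φ : R → F` into a field and an injective ring map `ι : R → K`
into a field: `finrank_F span{φ P_x} ≤ finrank_K span{ι P_x}` — every minor of the coefficient
matrix that is non-zero after `φ` is non-zero in `R`, hence after `ι`.
[cite: DuttaDwivediSaxena2022, §6.1 Claim 6.5 (full version p0046, L1228–1236)] -/
theorem finrank_span_range_map_le (ι : R →+* K) (hι : Function.Injective ι) (φ : R →+* F)
    (P : κ → MvPolynomial σ R) :
    Module.finrank F (Submodule.span F (Set.range fun x => map φ (P x))) ≤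
      Module.finrank K (Submodule.span K (Set.range fun x => map ι (P x))) := by
  classical
  set T : Finset (σ →₀ ℕ) := Finset.univ.biUnion fun x => (P x).support with hT
  have hT0 : ∀ x : κ, (P x).support ⊆ T := fun x =>
    hT ▸ Finset.subset_biUnion_of_mem (fun x => (P x).support) (Finset.mem_univ x)
  have hTφ : ∀ x : κ, (map φ (P x)).support ⊆ T := fun x =>
    (support_map_subset _ _).trans (hT0 x)
  have hTι : ∀ x : κ, (map ι (P x)).support ⊆ T := fun x =>
    (support_map_subset _ _).trans (hT0 x)
  rw [finrank_span_range_eq_rank T _ hTφ, finrank_span_range_eq_rank T _ hTι]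
  set M : Matrix κ T R := Matrix.of fun (x : κ) (m : T) => coeff m.1 (P x) with hM
  have hφ : (Matrix.of fun (x : κ) (m : T) => coeff m.1 (map φ (P x))) = M.map φ := by
    ext x m
    simp [hM, coeff_map]
  have hιM : (Matrix.of fun (x : κ) (m : T) => coeff m.1 (map ι (P x))) = M.map ι := by
    ext x m
    simp [hM, coeff_map]
  rw [hφ, hιM]
  exact Literature.Combinatorics.SimpleGraph.PRankLeRank.rank_map_le_rank_map ι hι φ M

end Specialisation

/-! ### Forbes's operators over a ring, and their images under `map` -/

section Operators

variable {R : Type*} [CommRing R] {σ : Type*}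

/-- Forbes's composite operator `(x_{i₁}+α_{i₁})∂_{i₁} ∘ ⋯ ∘ (x_{iᵣ}+α_{iᵣ})∂_{iᵣ}` along a list,
written over a commutative RING of coefficients (the tree's `shiftDerivList` is the same recursion
over a field); used for `R = F[ε]`. [cite: Forbes2015, §5.2 (the operators `(x+α)∘∂_x`)] -/
noncomputable def ringShiftDerivList (α : σ → R) : List σ → MvPolynomial σ R → MvPolynomial σ R
  | [] => fun P => P
  | i :: L => fun P => (X i + C (α i)) * MvPolynomial.pderiv i (ringShiftDerivList α L P)

/-- The empty composite is the identity. [cite: Forbes2015, §5.2 (the operators `(x+α)∘∂_x`)] -/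
@[simp] theorem ringShiftDerivList_nil (α : σ → R) (P : MvPolynomial σ R) :
    ringShiftDerivList α [] P = P := rfl

/-- Unfolding the composite along `i :: L`. [cite: Forbes2015, §5.2 (the operators `(x+α)∘∂_x`)] -/
@[simp] theorem ringShiftDerivList_cons (α : σ → R) (i : σ) (L : List σ) (P : MvPolynomial σ R) :
    ringShiftDerivList α (i :: L) P =
      (X i + C (α i)) * MvPolynomial.pderiv i (ringShiftDerivList α L P) := rfl

/-- The operators commute with a change of coefficients `χ : R → E` into a field:
`χ((x+α)^{1_L}∂_{x^{1_L}} P) = (x+χα)^{1_L}∂_{x^{1_L}} (χ P)`.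
[cite: DuttaDwivediSaxena2022, §6.1 Claim 6.5 (proof: "the respective operator-action … under the limit `ε = 0`")] -/
theorem map_ringShiftDerivList {E : Type*} [Field E] (χ : R →+* E) (α : σ → R) (L : List σ)
    (P : MvPolynomial σ R) :
    map χ (ringShiftDerivList α L P) = shiftDerivList (fun i => χ (α i)) L (map χ P) := by
  induction L with
  | nil => simp
  | cons i L ih =>
    rw [ringShiftDerivList_cons, shiftDerivList_cons, shiftDeriv_apply, map_mul, map_add, map_X,
      map_C, ← pderiv_map, ih]

/-- The index type of the measure's spanning family: a `k`-set `B` of variables and a shift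
exponent of degree `≤ ℓ`. [cite: Forbes2015, §6 (the measure `x^{≤ℓ}((x+α)∘∂_x)^{≤k}`)] -/
abbrev MeasIndex (σ : Type*) (k ℓ : ℕ) : Type _ :=
  {B : Finset σ // B.card = k} × {c : σ →₀ ℕ // c.degree ≤ ℓ}

/-- The measure's spanning family over the ring `R`: `x^c · (x+α)^{1_B}∂_{x^{1_B}} P`.
[cite: Forbes2015, §6 (the measure)] -/
noncomputable def ringMeasFamily (α : σ → R) (P : MvPolynomial σ R) (k ℓ : ℕ) :
    MeasIndex σ k ℓ → MvPolynomial σ R :=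
  fun x => monomial x.2.1 1 * ringShiftDerivList α x.1.1.toList P

/-- Over a field, the measure is the span of the family `x^c · (x+α)^{1_B}∂_{x^{1_B}} g`,
`|B| = k`, `deg c ≤ ℓ`. [cite: Forbes2015, §6 (the measure)] -/
theorem measure_eq_span_range {E : Type*} [Field E] [Fintype σ] (α : σ → E)
    (g : MvPolynomial σ E) (k ℓ : ℕ) :
    measure α g k ℓ = Submodule.span E (Set.range fun x : MeasIndex σ k ℓ =>
      monomial x.2.1 (1 : E) * shiftDerivList α x.1.1.toList g) := by
  unfold measure
  congr 1
  ext q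
  constructor
  · rintro ⟨B, hB, c, hc, rfl⟩
    exact ⟨(⟨B, hB⟩, ⟨c, hc⟩), rfl⟩
  · rintro ⟨⟨⟨B, hB⟩, ⟨c, hc⟩⟩, rfl⟩
    exact ⟨B, hB, c, hc, rfl⟩

/-- The field-level family is the image of the ring-level one.
[cite: DuttaDwivediSaxena2022, §6.1 Claim 6.5 (proof)] -/
theorem map_ringMeasFamily {E : Type*} [Field E] (χ : R →+* E) (α : σ → R)
    (P : MvPolynomial σ R) (k ℓ : ℕ) (x : MeasIndex σ k ℓ) :
    map χ (ringMeasFamily α P k ℓ x) =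
      monomial x.2.1 (1 : E) * shiftDerivList (fun i => χ (α i)) x.1.1.toList (map χ P) := by
  rw [ringMeasFamily, map_mul, map_monomial, map_one, map_ringShiftDerivList]

end Operators

/-! ### DDS Claim 6.5: the measure of the limit is at most the measure of the approximant -/

section Claim65

variable {R K F : Type*} [CommRing R] [Field K] [Field F] {σ : Type*} [Fintype σ]

/-- The index type of the measure family is finite (finitely many `k`-sets and finitely many
exponents of degree `≤ ℓ` over finitely many variables). [cite: Forbes2015, §6 (the measure, a finite-dimensional span)] -/
theorem MeasIndex.finite (σ : Type*) [Finite σ] (k ℓ : ℕ) : Finite (MeasIndex σ k ℓ) := by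
  haveI : Finite {c : σ →₀ ℕ // c.degree ≤ ℓ} := (Finsupp.finite_of_degree_le (σ := σ) ℓ).to_subtype
  infer_instance

/-- Over a field the measure is finite-dimensional (a span of a finite family).
[cite: Forbes2015, §6 (the measure)] -/
theorem measure_moduleFinite {E : Type*} [Field E] (α : σ → E) (g : MvPolynomial σ E) (k ℓ : ℕ) :
    Module.Finite E (measure α g k ℓ) := by
  haveI := MeasIndex.finite σ k ℓ
  rw [measure_eq_span_range]
  exact Module.Finite.span_of_finite E (Set.finite_range _)

/-- **DDS Claim 6.5 (`rk_F N(ρ(f)) ≤ rk_{F(ε)} N(ρ(g))`), abstract form.** For `P ∈ R[x_1..x_n]`,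
`φ : R → F` a ring map into a field and `ι : R → K` an injective ring map into a field, Forbes's
measure of `φ P` (shift `φ∘α`) has `F`-dimension at most the `K`-dimension of the measure of `ι P`
(shift `ι∘α`), for all orders `k`, `ℓ`.
[cite: DuttaDwivediSaxena2022, §6.1 Claim 6.5 (full version p0046, L1228–1236)] -/
theorem finrank_measure_map_le (ι : R →+* K) (hι : Function.Injective ι) (φ : R →+* F)
    (α : σ → R) (P : MvPolynomial σ R) (k ℓ : ℕ) :
    Module.finrank F (measure (fun i => φ (α i)) (map φ P) k ℓ) ≤
      Module.finrank K (measure (fun i => ι (α i)) (map ι P) k ℓ) := by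
  classical
  haveI := MeasIndex.finite σ k ℓ
  haveI : Fintype (MeasIndex σ k ℓ) := Fintype.ofFinite _
  rw [measure_eq_span_range, measure_eq_span_range]
  have hφ : (fun x : MeasIndex σ k ℓ =>
      monomial x.2.1 (1 : F) * shiftDerivList (fun i => φ (α i)) x.1.1.toList (map φ P)) =
      fun x => map φ (ringMeasFamily α P k ℓ x) := by
    funext x; rw [map_ringMeasFamily]
  have hιf : (fun x : MeasIndex σ k ℓ =>
      monomial x.2.1 (1 : K) * shiftDerivList (fun i => ι (α i)) x.1.1.toList (map ι P)) =
      fun x => map ι (ringMeasFamily α P k ℓ x) := by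
    funext x; rw [map_ringMeasFamily]
  rw [hφ, hιf]
  exact finrank_span_range_map_le ι hι φ _

end Claim65

/-! ### The measure inequality and the support bound in the approximative setting -/

section Border

variable {R K F : Type*} [CommRing R] [Field K] [Field F]
variable {Λ : Type*} [AddCommMonoid Λ] [LinearOrder Λ] [IsOrderedCancelAddMonoid Λ]
variable {n : ℕ}

/-- **The measure inequality for an approximated sum (DDS §6.1: Lemma 6.1 + (6.1) via Claim 6.5;
Forbes Prop. 6.5 with the two bounds taken on the two sides of `ε → 0`).** Let `P ∈ R[x_1..x_n]`
with `ι P = Σ_{i<s} u_i G_i^{d_i}` over `K` (`u_i` log-affine for the shift `ι∘α`, `deg G_i ≤ t`)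
and suppose `φ P ∈ F[x]` has a trailing monomial `a` of full support whose exponents are nonzero
in `F`, the shift `φ∘α` having full support. Then for all `k, ℓ`:
`C(n,k)·C(n−k+ℓ,ℓ) ≤ s·(k+1)·C(n+tk+ℓ, tk+ℓ)`.
[cite: DuttaDwivediSaxena2022, §6.1 Lemma 6.4 (proof, full version p0046 L1226 – p0047 L1242)] -/
theorem border_choose_mul_choose_le (ι : R →+* K) (hι : Function.Injective ι) (φ : R →+* F)
    {r : (Fin n →₀ ℕ) →+ Λ} (hr : Function.Injective r) (hmono : Monotone r)
    {α : Fin n → R} (hα : ∀ i, φ (α i) ≠ 0) (P : MvPolynomial (Fin n) R)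
    {s t : ℕ} {u G : Fin s → MvPolynomial (Fin n) K} {d : Fin s → ℕ}
    (hu : ∀ i, LogAffine (fun j => ι (α j)) (u i)) (hG : ∀ i, (G i).totalDegree ≤ t)
    (hg : map ι P = ∑ i, u i * G i ^ d i)
    {a : Fin n →₀ ℕ} (hf : IsTrailing r (map φ P) a) (ha : ∀ i, (a i : F) ≠ 0) (k ℓ : ℕ) :
    n.choose k * (n - k + ℓ).choose ℓ ≤ s * (k + 1) * (n + (t * k + ℓ)).choose (t * k + ℓ) := by
  classical
  haveI : Finite {c : Fin (n - k) →₀ ℕ // c.degree ≤ ℓ} :=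
    (Finsupp.finite_of_degree_le (σ := Fin (n - k)) ℓ).to_subtype
  haveI : Finite {c : Fin n →₀ ℕ // c.degree ≤ t * k + ℓ} :=
    (Finsupp.finite_of_degree_le (σ := Fin n) (t * k + ℓ)).to_subtype
  haveI : Fintype (LBIndex n k ℓ) := Fintype.ofFinite _
  set αF : Fin n → F := fun j => φ (α j) with hαF
  set αK : Fin n → K := fun j => ι (α j) with hαK
  set fF : MvPolynomial (Fin n) F := map φ P with hfF
  -- (1) the lower bound, over `F`: Forbes's family `E` is linearly independent in the measure
  set MF := measure αF fF k ℓ with hMF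
  haveI : Module.Finite F MF := measure_moduleFinite αF fF k ℓ
  have ha1 : ∀ i, 1 ≤ a i := fun i =>
    Nat.one_le_iff_ne_zero.mpr fun h0 => ha i (by rw [h0, Nat.cast_zero])
  have hli : LinearIndependent F (lbFamily αF fF k ℓ) :=
    linearIndependent_of_isTrailing hr _ _ (lbExponent_injective a ha1 k ℓ)
      (isTrailing_lbFamily hr hmono hα hf ha k ℓ)
  have hli' : LinearIndependent F (fun x : LBIndex n k ℓ =>
      (⟨lbFamily αF fF k ℓ x, lbFamily_mem_measure αF fF k ℓ x⟩ : MF)) :=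
    LinearIndependent.of_comp MF.subtype (by exact hli)
  have h1 : n.choose k * (n - k + ℓ).choose ℓ ≤ Module.finrank F MF := by
    have := hli'.fintype_card_le_finrank
    rwa [← Nat.card_eq_fintype_card, card_LBIndex] at this
  -- (2) Claim 6.5: the measure does not grow in the limit
  have h2 : Module.finrank F MF ≤ Module.finrank K (measure αK (map ι P) k ℓ) :=
    finrank_measure_map_le ι hι φ α P k ℓ
  -- (3) the upper bound, over `K` (Forbes Cor. 6.4)
  set W := Submodule.span K (Set.range (ubFamily u G d (t * k + ℓ) k)) with hW
  haveI : Module.Finite K W := Module.Finite.span_of_finite K (Set.finite_range _)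
  have h3 : Module.finrank K (measure αK (map ι P) k ℓ) ≤ Module.finrank K W := by
    refine Submodule.finrank_mono ?_
    rw [hg]
    exact measure_le_span_ubFamily hu hG
  exact h1.trans (h2.trans (h3.trans (finrank_span_ubFamily_le u G d _ k)))

/-- **DDS Lemma 6.4 (trailing monomial support), core form = Forbes Prop. 6.5 for an approximated
sum, with the linear constant of `Forbes15SupportBoundLinear`:** under the hypotheses of
`border_choose_mul_choose_le`, `n < 33(t+2)·(⌊log₂ s⌋+1)`.
[cite: DuttaDwivediSaxena2022, §6.1 Lemma 6.4 (full version p0046, L1220–1222)] -/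
theorem border_card_lt_of_isTrailing_linear (ι : R →+* K) (hι : Function.Injective ι)
    (φ : R →+* F) {r : (Fin n →₀ ℕ) →+ Λ} (hr : Function.Injective r) (hmono : Monotone r)
    {α : Fin n → R} (hα : ∀ i, φ (α i) ≠ 0) (P : MvPolynomial (Fin n) R)
    {s t : ℕ} {u G : Fin s → MvPolynomial (Fin n) K} {d : Fin s → ℕ}
    (hu : ∀ i, LogAffine (fun j => ι (α j)) (u i)) (hG : ∀ i, (G i).totalDegree ≤ t)
    (hg : map ι P = ∑ i, u i * G i ^ d i)
    {a : Fin n →₀ ℕ} (hf : IsTrailing r (map φ P) a) (ha : ∀ i, (a i : F) ≠ 0) :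
    n < 33 * (t + 2) * (Nat.log 2 s + 1) :=
  lt_of_measureIneq_linear fun k ℓ _ =>
    border_choose_mul_choose_le ι hι φ hr hmono hα P hu hG hg hf ha k ℓ

/-- **The `ε`-border instance** (`R = F[ε]`, `K = F(ε) = RatFunc F`, `φ = ` constant term,
shift `α ∈ F^n` of full support read as constants of `F[ε]`): if `P ∈ F[ε][x_1..x_n]` becomes,
in `F(ε)[x]`, a sum `Σ_{i<s} u_i G_i^{d_i}` with `u_i` log-affine for `α` and `deg G_i ≤ t`, and its
constant term `P|_{ε=0} ∈ F[x]` has a trailing monomial of full support with exponents nonzero in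
`F`, then `n < 33(t+2)·(⌊log₂ s⌋+1)`.
[cite: DuttaDwivediSaxena2022, §6.1 Lemma 6.4 and Claim 6.5 (full version p0046)] -/
theorem border_card_lt_of_isTrailing_linear_ratFunc {r : (Fin n →₀ ℕ) →+ Λ}
    (hr : Function.Injective r) (hmono : Monotone r) {α : Fin n → F} (hα : ∀ i, α i ≠ 0)
    (P : MvPolynomial (Fin n) (Polynomial F))
    {s t : ℕ} {u G : Fin s → MvPolynomial (Fin n) (RatFunc F)} {d : Fin s → ℕ}
    (hu : ∀ i, LogAffine (fun j => algebraMap F (RatFunc F) (α j)) (u i))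
    (hG : ∀ i, (G i).totalDegree ≤ t)
    (hg : map (algebraMap (Polynomial F) (RatFunc F)) P = ∑ i, u i * G i ^ d i)
    {a : Fin n →₀ ℕ} (hf : IsTrailing r (map Polynomial.constantCoeff P) a)
    (ha : ∀ i, (a i : F) ≠ 0) :
    n < 33 * (t + 2) * (Nat.log 2 s + 1) := by
  have hαC : ∀ i, Polynomial.constantCoeff (Polynomial.C (α i)) ≠ 0 := fun i => by
    rw [Polynomial.constantCoeff_apply, Polynomial.coeff_C_zero]; exact hα i
  have hu' : ∀ i, LogAffine
      (fun j => algebraMap (Polynomial F) (RatFunc F) (Polynomial.C (α j))) (u i) := by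
    intro i
    have : (fun j => algebraMap (Polynomial F) (RatFunc F) (Polynomial.C (α j))) =
        fun j => algebraMap F (RatFunc F) (α j) := by
      funext j
      rw [RatFunc.algebraMap_C]
      rfl
    rw [this]; exact hu i
  exact border_card_lt_of_isTrailing_linear (algebraMap (Polynomial F) (RatFunc F))
    (RatFunc.algebraMap_injective F) Polynomial.constantCoeff hr hmono hαC P hu' hG hg hf ha

end Border

end Literature.Computability.AlgebraicComplexity.Forbes15
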